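import Literature.Computability.AlgebraicComplexity.PerDetHwvCertificate
import Literature.Computability.AlgebraicComplexity.PlethysmTableauPerms
import Literature.Computability.AlgebraicComplexity.TableauEvalBridge
import Mathlib.LinearAlgebra.Matrix.Determinant.Basic
import Mathlib.Algebra.BigOperators.Fin
import Mathlib.Data.List.GetD
import Mathlib.Data.List.InsertIdx
import HarnessLib

/-!
# Certificate evaluation commutes with ring maps; the list determinant is Mathlib's determinant

Proofs file for `PlethysmTableauEvaluation.lean` / `PerDetHwvCertificate.lean` (Lean checker of
the GCT multiplicity-obstruction engine, cell `pub-gct`; honest framing: rung-1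
multiplicity-obstruction search for permanent versus determinant at small `(n, m)`, no claim about
VP ≠ VNP or P ≠ NP). Two elementary facts that turn the kernel's mod-`p` arithmetic into
statements over `ℤ`, `ℚ`, `ℂ`:

* §1 **naturality**: every function of the evaluator commutes with a ring homomorphism
  `f : R →+* S` applied entrywise (`ldet_map`, `eval_map`, `evalC_map`, `paddedPermPoint_map`,
  `detL_map`); in particular the certificate's entry mod `p` is the reduction of the INTEGER
  `evalC (paddedPermPoint n m g) N` (`Cert.entry_eq_cast_evalInt`), so "`≠ 0 mod p`" gives "`≠ 0`
  in `ℤ`" and then in any characteristic-zero field;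
* §2 **the bridge** `detL_eq_det`: the fuelled Laplace expansion `detL` of a list matrix is the
  `Matrix.det` of the corresponding `Fin n`-indexed matrix `matOfRows` (`PlethysmTableauPerms`;
  induction on `n` with Mathlib's `Matrix.det_succ_row_zero`), so a nonzero `detL` is a
  nonsingular evaluation matrix in the sense of `HwvEvaluationRankBound.lean`.

Everything is list bookkeeping [folklore].
-/

open scoped BigOperators

namespace Literature.Computability.AlgebraicComplexity

namespace TableauEval

/-! ## §1 Naturality under ring homomorphisms -/

section Naturality

variable {R S : Type*} [CommRing R] [CommRing S] (f : R →+* S)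

/-- Entrywise image of a point under a ring map. [folklore] -/
def Point.map (P : Point R) : Point S :=
  ⟨P.terms.map fun t => (f t.1, t.2.map fun l => l.map f)⟩

/-- `sgn` is preserved by ring maps. [folklore] -/
@[simp]
theorem map_sgn (b : Bool) : f (sgn b) = sgn b := by
  cases b <;> simp [sgn]

/-- Reading an entry commutes with mapping (default `0 ↦ 0`). [folklore] -/
theorem getD_map_zero (l : List R) (j : ℕ) : (l.map f).getD j 0 = f (l.getD j 0) :=
  getD_map_congr f (map_zero f) l j

/-- The Leibniz determinant commutes with ring maps. [folklore] -/
theorem ldet_map (M : List (List R)) : ldet (M.map fun row => row.map f) = f (ldet M) := by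
  unfold ldet
  rw [List.length_map, map_list_sum, List.map_map]
  congr 1
  refine List.map_congr_left fun q _ => ?_
  simp only [Function.comp_apply, map_mul, map_sgn, map_list_prod, List.map_zipWith,
    List.zipWith_map_left, getD_map_zero]

/-- The number of terms is unchanged by mapping, hence so are the label options. [folklore] -/
theorem options_map (P : Point R) (m : ℕ) : options (P.map f) m = options P m := by
  simp [options, Point.map]

/-- The linear form in a box commutes with mapping. [folklore] -/
theorem boxForm_map (P : Point R) (asg : List (ℕ × List ℕ)) (u q : ℕ) :
    boxForm (P.map f) asg u q = (boxForm P asg u q).map f := by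
  unfold boxForm Point.map
  simp only
  rw [getD_map_congr (fun t : R × List (List R) => (f t.1, t.2.map fun l => l.map ⇑f))
    (d := ((0 : R), ([] : List (List R)))) (by simp)]
  exact getD_map_congr (fun l : List R => l.map ⇑f) (d := ([] : List R)) (by simp) _ _

/-- The column matrix commutes with mapping. [folklore] -/
theorem colMatrix_map (P : Point R) (asg : List (ℕ × List ℕ)) (c : Column) (ann : List (ℕ × ℕ)) :
    colMatrix (P.map f) asg c ann = (colMatrix P asg c ann).map fun row => row.map f := by
  unfold colMatrix
  simp only [List.map_map, boxForm_map]
  refine List.map_congr_left fun b _ => ?_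
  simp only [Function.comp_apply, List.map_map]
  refine List.map_congr_left fun e _ => ?_
  simp only [Function.comp_apply, getD_map_zero]

/-- The coefficient product commutes with mapping. [folklore] -/
theorem coeffProd_map (P : Point R) (asg : List (ℕ × List ℕ)) (d : ℕ) :
    coeffProd (P.map f) asg d = f (coeffProd P asg d) := by
  unfold coeffProd Point.map
  rw [map_list_prod, List.map_map]
  congr 1
  refine List.map_congr_left fun u _ => ?_
  simp only [Function.comp_apply]
  rw [getD_map_congr (fun t : R × List (List R) => (f t.1, t.2.map fun l => l.map ⇑f))
    (d := ((0 : R), ([] : List (List R)))) (by simp)]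

/-- The leaf value commutes with mapping. [folklore] -/
theorem leaf_map (P : Point R) (N : Network) (asg : List (ℕ × List ℕ)) :
    leaf (P.map f) N asg = f (leaf P N asg) := by
  unfold leaf
  rw [map_mul, coeffProd_map, map_list_prod, List.map_zipWith]
  congr 1
  simp only [colMatrix_map, ldet_map]

/-- The label recursion commutes with mapping. [folklore] -/
theorem evalLabels_map (P : Point R) (N : Network) (opts : List (ℕ × List ℕ)) :
    ∀ (us : List ℕ) (asg : List (ℕ × List ℕ)),
      evalLabels (P.map f) N opts us asg = f (evalLabels P N opts us asg)
  | [], asg => by simp only [evalLabels, leaf_map]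
  | _ :: us, asg => by
    simp only [evalLabels]
    rw [map_list_sum, List.map_map]
    congr 1
    refine List.map_congr_left fun o _ => ?_
    simp only [Function.comp_apply, evalLabels_map P N opts us]

/-- **Naturality of the evaluation**: `eval` commutes with ring homomorphisms. In particular a
value that is nonzero modulo `p` is nonzero in `ℤ`, hence in every characteristic-zero field.
[folklore] -/
theorem eval_map (P : Point R) (N : Network) : eval (P.map f) N = f (eval P N) := by
  unfold eval
  rw [options_map, evalLabels_map]

/-- The list permanent commutes with ring maps. [folklore] -/
theorem lperm_map (M : List (List R)) : lperm (M.map fun row => row.map f) = f (lperm M) := by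
  unfold lperm
  rw [List.length_map, map_list_sum, List.map_map]
  congr 1
  refine List.map_congr_left fun q _ => ?_
  simp only [Function.comp_apply, map_list_prod, List.map_zipWith, List.zipWith_map_left,
    getD_map_zero]

/-- The symmetric-tensor entry commutes with mapping. [folklore] -/
theorem symEntry_map (P : Point R) (idx : List ℕ) :
    symEntry (P.map f) idx = f (symEntry P idx) := by
  unfold symEntry Point.map
  rw [map_list_sum, List.map_map, List.map_map]
  congr 1
  refine List.map_congr_left fun t _ => ?_
  simp only [Function.comp_apply, map_mul, ← lperm_map, List.map_map]
  congr 2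
  refine List.map_congr_left fun ℓ _ => ?_
  simp only [Function.comp_apply, List.map_map]
  refine List.map_congr_left fun i _ => ?_
  simp only [Function.comp_apply, getD_map_zero]

/-- The column recursion commutes with mapping. [folklore] -/
theorem evalCols_map (P : Point R) : ∀ (cs : List Column) (acc : List (List ℕ)),
    evalCols (P.map f) cs acc = f (evalCols P cs acc)
  | [], acc => by
    simp only [evalCols, map_list_prod, List.map_map]
    congr 1
    refine List.map_congr_left fun l _ => ?_
    simp only [Function.comp_apply, symEntry_map]
  | c :: cs, acc => by
    simp only [evalCols]
    rw [map_list_sum, List.map_map]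
    congr 1
    refine List.map_congr_left fun q _ => ?_
    simp only [Function.comp_apply, map_mul, map_sgn, evalCols_map P cs]

/-- **Naturality of the column-bijection evaluation** `evalC`. [folklore] -/
theorem evalC_map (P : Point R) (N : Network) : evalC (P.map f) N = f (evalC P N) := by
  unfold evalC
  rw [evalCols_map]

/-- Columns commute with mapping. [folklore] -/
theorem colOf_map (g : List (List R)) (v : ℕ) :
    colOf (g.map fun row => row.map f) v = (colOf g v).map f := by
  simp only [colOf, List.map_map]
  refine List.map_congr_left fun row _ => ?_
  simp only [Function.comp_apply, getD_map_zero]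

/-- The padded-permanent point commutes with mapping. [folklore] -/
theorem paddedPermPoint_map (n m : ℕ) (g : List (List R)) :
    paddedPermPoint n m (g.map fun row => row.map f) = (paddedPermPoint n m g).map f := by
  unfold paddedPermPoint Point.map
  simp only [List.map_map]
  congr 1
  refine List.map_congr_left fun σ _ => ?_
  simp only [Function.comp_apply, map_one, List.map_append, List.map_map, List.map_replicate,
    colOf_map, Function.comp_def]

/-- `matCast` into `S` factors through `matCast` into `R` along `f`. [folklore] -/
theorem matCast_map (g : List (List ℤ)) :
    (matCast (R := R) g).map (fun row => row.map f) = matCast (R := S) g := by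
  simp only [matCast, List.map_map]
  refine List.map_congr_left fun row _ => ?_
  simp only [Function.comp_apply, List.map_map]
  refine List.map_congr_left fun a _ => ?_
  simp

/-- `matCast` into `ℤ` is the identity. [folklore] -/
theorem matCast_int (g : List (List ℤ)) : matCast (R := ℤ) g = g := by
  simp [matCast]

/-- The alternating sum commutes with ring maps. [folklore] -/
theorem altSum_map : ∀ l : List R, altSum (l.map f) = f (altSum l)
  | [] => by simp [altSum]
  | a :: l => by simp [altSum, altSum_map l]

/-- The Laplace determinant commutes with ring maps. [folklore] -/
theorem detL_map : ∀ (n : ℕ) (M : List (List R)),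
    detL n (M.map fun row => row.map f) = f (detL n M)
  | 0, M => by simp [detL]
  | n + 1, [] => by simp [detL]
  | n + 1, row :: rest => by
    rw [List.map_cons, detL, detL, ← altSum_map, List.map_map, List.length_map]
    congr 1
    refine List.map_congr_left fun j _ => ?_
    simp only [Function.comp_apply, map_mul, getD_map_zero, List.map_map]
    congr 1
    rw [← detL_map n]
    congr 1
    rw [List.map_map]
    refine List.map_congr_left fun r _ => ?_
    simp only [Function.comp_apply, List.eraseIdx_map]

end Naturality

/-! ### The certificate's entries are reductions of integers -/

/-- The INTEGER value of network `i` at point `j` of a certificate: `evalC` over `ℤ` of the padded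
permanent point of the `j`-th matrix. [folklore] -/
def Cert.evalInt (c : Cert) (i j : ℕ) : ℤ :=
  evalC (paddedPermPoint c.n c.m (c.points.getD j [])) (c.hwvs.getD i ⟨0, 0, []⟩)

/-- The mod-`p` entry recomputed by `Cert.verify` is the reduction of `Cert.evalInt`. [folklore] -/
theorem Cert.entry_eq_cast_evalInt (c : Cert) (p : ℕ) (i j : ℕ) :
    c.entry p i j = (Int.castRingHom (ZMod p)) (c.evalInt i j) := by
  unfold Cert.entry Cert.pointMod Cert.evalInt
  rw [← evalC_map, ← paddedPermPoint_map, ← matCast_map (Int.castRingHom (ZMod p)), matCast_int]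

/-! ## §2 The Laplace list determinant is `Matrix.det` -/

section Bridge

variable {R : Type*} [CommRing R]

/-- Indexing an erased list: position `j` of `l.eraseIdx b` is position `b.succAbove j` of `l`.
[folklore] -/
theorem getD_eraseIdx_succAbove {α : Type*} {n : ℕ} (l : List α) (b : Fin (n + 1)) (j : Fin n)
    (d : α) : (l.eraseIdx b).getD j d = l.getD (b.succAbove j) d := by
  rw [List.getD_eq_getElem?_getD, List.getD_eq_getElem?_getD, List.getElem?_eraseIdx]
  by_cases h : (j : ℕ) < b
  · rw [if_pos h, Fin.succAbove_of_castSucc_lt b j h]; rfl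
  · rw [if_neg h, Fin.succAbove_of_le_castSucc b j (not_lt.1 h)]; rfl

/-- The alternating sum of `a s, a (s+1), …` as a signed `Fin` sum. [folklore] -/
theorem altSum_map_range' (a : ℕ → R) : ∀ (N s : ℕ),
    altSum ((List.range' s N).map a) = ∑ j : Fin N, (-1) ^ (j : ℕ) * a (s + j)
  | 0, s => by simp [altSum]
  | N + 1, s => by
    rw [List.range'_succ, List.map_cons, altSum, altSum_map_range' a N (s + 1), Fin.sum_univ_succ]
    simp only [Fin.val_zero, pow_zero, one_mul, add_zero, Fin.val_succ, pow_succ, mul_neg_one,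
      neg_mul, Finset.sum_neg_distrib]
    rw [sub_eq_add_neg]
    congr 1
    congr 1
    refine Finset.sum_congr rfl fun j _ => ?_
    rw [show s + 1 + (j : ℕ) = s + ((j : ℕ) + 1) by ring]

/-- **Bridge**: on a list of `n` rows each of length `n`, `detL n` is the determinant of
`matOfRows n` (Laplace expansion along the first row on both sides, `Matrix.det_succ_row_zero`;
the row-length hypothesis is needed because `detL` expands along the `row.length` entries of the
first row). [folklore] -/
theorem detL_eq_det : ∀ (n : ℕ) (L : List (List R)), L.length = n → (∀ row ∈ L, row.length = n) →
    detL n L = (matOfRows n L).det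
  | 0, L, _, _ => by simp [detL, matOfRows]
  | n + 1, [], hL, _ => by simp at hL
  | n + 1, row :: rest, hL, hrows => by
    have hrow : row.length = n + 1 := hrows row (by simp)
    have hrest : rest.length = n := by simpa using hL
    rw [detL, hrow, List.range_eq_range', altSum_map_range', Matrix.det_succ_row_zero]
    refine Finset.sum_congr rfl fun j _ => ?_
    rw [zero_add, mul_assoc]
    congr 1
    -- first-row entry
    have h0 : matOfRows (n + 1) (row :: rest) 0 j = row.getD j 0 := by
      simp [matOfRows]
    rw [h0]
    congr 1
    -- the minor
    have hlen : (rest.map fun r => r.eraseIdx j).length = n := by simp [hrest]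
    have hlen' : ∀ r ∈ (rest.map fun r => r.eraseIdx (j : ℕ)), r.length = n := by
      intro r hr
      obtain ⟨r', hr', rfl⟩ := List.mem_map.mp hr
      have : r'.length = n + 1 := hrows r' (by simp [hr'])
      rw [List.length_eraseIdx, this, if_pos j.isLt]
      rfl
    rw [detL_eq_det n _ hlen hlen']
    congr 1
    ext i l
    simp only [matOfRows, Matrix.submatrix_apply, Matrix.of_apply, List.getD_cons_succ,
      Fin.val_succ]
    rw [getD_map_congr (fun r : List R => r.eraseIdx (j : ℕ)) (d := ([] : List R)) (by simp),
      getD_eraseIdx_succAbove]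

end Bridge

end TableauEval

end Literature.Computability.AlgebraicComplexity
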